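import Summits.PneNP.PneNP.Theses.KarlinRubin

/-!
# Edge boundary of an up-set of the Boolean cube: `bdry² ≤ N · 4^N`

The total influence of a monotone Boolean function of `N` variables is at most `√N` (O'Donnell 2014,
§2.3; majority is extremal), in the integer form used downstream: for an up-set `F ⊆ {0,1}^N`, the
number `bdry F` of cube edges leaving `F` downwards satisfies `(bdry F)² ≤ N · 4^N` (`bdry_sq_le`).
Proof: in direction `c` the points of `F` with `c`-bit `1` outnumber those with `c`-bit `0` by exactly
the number of boundary edges in direction `c` (`card_filter_true_eq`), so `bdry F = ∑_{x ∈ F} (2|x| - N)`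
(`bdry_eq_sum`); Cauchy–Schwarz against the second moment `∑_x (2|x| - N)² = N · 2^N` (`sum_sq_weight`,
by orthogonality of the `±1` coordinate signs under the coordinate-flip involution).

Part of the negative-side lemma `monotoneSuffices_false_without_productNoise` for the crux
`Summit.PneNP.PneNP.Theses.KarlinRubin.MonotoneSuffices` (stmt-PneNP-18026, route PneNP/KarlinRubin):
the OR-channel (stochastic-order) generalisation of the crux is false — see
`Summits/PneNP/PneNP/Theorems/MonotoneSuffices/Negative/ORChannel.lean` for the statement, the witness
and the discussion. Everything here is proved (no named facts). Refuter seat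
refuter-cdisprove-stmt-PneNP-18026-0 (cdisprove, cycle 1), 2026-08-17.

References: R. O'Donnell, *Analysis of Boolean Functions*, CUP (2014), §2.3 [ODonnell2014].
-/

set_option linter.dupNamespace false -- `Summit.PneNP.PneNP.…`: summit = sub-problem name (D-0017 single-conjunct layout)

namespace Summit.PneNP.PneNP.Theorems.MonotoneSuffices.Negative

open Finset Function

section Cube

variable {ι : Type*} [Fintype ι] [DecidableEq ι]

/-- Lower endpoints of the boundary edges of `F` in direction `c`: points `y ∉ F` with `y c = 0`
whose upper neighbour `y[c ↦ 1]` lies in `F`. [folklore] -/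
def lowerBdry (F : Finset (ι → Bool)) (c : ι) : Finset (ι → Bool) :=
  univ.filter fun y => y ∉ F ∧ y c = false ∧ update y c true ∈ F

/-- Total edge boundary of `F` (number of cube edges leaving `F` downwards). [folklore] -/
def bdry (F : Finset (ι → Bool)) : ℕ := ∑ c, (lowerBdry F c).card

/-- Hamming weight. [folklore] -/
def wt (x : ι → Bool) : ℕ := (univ.filter fun c => x c = true).card

/-- The `±1` sign of coordinate `c` at `x`. [folklore] -/
def sgn (x : ι → Bool) (c : ι) : ℤ := if x c = true then 1 else -1

omit [DecidableEq ι] in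
/-- The signs of `x` sum to `2|x| - N`. [folklore] -/
theorem sum_sgn_eq (x : ι → Bool) : ∑ c, sgn x c = 2 * (wt x : ℤ) - Fintype.card ι := by
  have h1 : ∑ c, sgn x c = ∑ c, ((if x c = true then (1 : ℤ) else 0) - (if x c = true then 0 else 1)) := by
    refine Finset.sum_congr rfl fun c _ => ?_
    unfold sgn
    split_ifs <;> simp
  rw [h1, Finset.sum_sub_distrib]
  have h2 : ∑ c, (if x c = true then (1 : ℤ) else 0) = (wt x : ℤ) := by
    rw [wt, Finset.card_filter]
    push_cast
    rfl
  have h3 : ∑ c, (if x c = true then (0 : ℤ) else 1) = (Fintype.card ι : ℤ) - wt x := by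
    have : ∑ c, (if x c = true then (0 : ℤ) else 1) = ((univ.filter fun c => ¬ x c = true).card : ℤ) := by
      rw [Finset.card_filter]
      push_cast
      refine Finset.sum_congr rfl fun c _ => ?_
      split_ifs <;> simp
    rw [this]
    have hc := Finset.card_filter_add_card_filter_not (s := (univ : Finset ι)) (fun c => x c = true)
    rw [Finset.card_univ] at hc
    have : ((univ.filter fun c => ¬ x c = true).card : ℤ) = Fintype.card ι - (univ.filter fun c => x c = true).card := by
      omega
    rw [this, wt]
  rw [h2, h3]
  ring

/-- In an up-set, the points with `c`-bit `1` outnumber those with `c`-bit `0` by exactly the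
number of boundary edges in direction `c`. [folklore] -/
theorem card_filter_true_eq (F : Finset (ι → Bool)) (hF : IsUpperSet (F : Set (ι → Bool))) (c : ι) :
    (F.filter fun x => x c = true).card =
      (F.filter fun x => x c = false).card + (lowerBdry F c).card := by
  set L : Finset (ι → Bool) := univ.filter fun y => y c = false ∧ update y c true ∈ F with hL
  have hLeq : L = (F.filter fun x => x c = false) ∪ lowerBdry F c := by
    ext y
    simp only [hL, lowerBdry, mem_filter, mem_univ, true_and, mem_union]
    constructor
    · rintro ⟨hyc, hup⟩
      by_cases hy : y ∈ F
      · exact Or.inl ⟨hy, hyc⟩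
      · exact Or.inr ⟨hy, hyc, hup⟩
    · rintro (⟨hy, hyc⟩ | ⟨-, hyc, hup⟩)
      · refine ⟨hyc, hF (fun d => ?_) hy⟩
        by_cases hd : d = c
        · subst hd; rw [update_self, hyc]; exact Bool.false_le _
        · rw [update_of_ne hd]
      · exact ⟨hyc, hup⟩
  have hdisj : Disjoint (F.filter fun x => x c = false) (lowerBdry F c) := by
    rw [Finset.disjoint_left]
    intro y hy hy'
    exact (mem_filter.1 hy').2.1 (mem_filter.1 hy).1
  have himg : L.image (fun y => update y c true) = F.filter fun x => x c = true := by
    ext z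
    simp only [mem_image, hL, mem_filter, mem_univ, true_and]
    constructor
    · rintro ⟨y, ⟨-, hup⟩, rfl⟩
      exact ⟨hup, by simp⟩
    · rintro ⟨hz, hzc⟩
      refine ⟨update z c false, ⟨by simp, ?_⟩, ?_⟩
      · rw [update_idem]
        convert hz using 1
        rw [← hzc]; exact update_eq_self c z
      · rw [update_idem, ← hzc]; exact update_eq_self c z
  have hinj : Set.InjOn (fun y : ι → Bool => update y c true) L := by
    intro y hy y' hy' h
    have hyc : y c = false := (mem_filter.1 (Finset.mem_coe.1 hy)).2.1
    have hyc' : y' c = false := (mem_filter.1 (Finset.mem_coe.1 hy')).2.1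
    funext d
    by_cases hd : d = c
    · subst hd; rw [hyc, hyc']
    · have := congrFun h d
      simpa [update_of_ne hd] using this
  calc (F.filter fun x => x c = true).card = (L.image fun y => update y c true).card := by rw [himg]
    _ = L.card := Finset.card_image_of_injOn hinj
    _ = _ := by rw [hLeq, Finset.card_union_of_disjoint hdisj]

/-- The boundary of an up-set as a weight sum: `bdry F = ∑_{x ∈ F} (2|x| - N)`. [folklore] -/
theorem bdry_eq_sum (F : Finset (ι → Bool)) (hF : IsUpperSet (F : Set (ι → Bool))) :
    (bdry F : ℤ) = ∑ x ∈ F, (2 * (wt x : ℤ) - Fintype.card ι) := by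
  have h1 : (bdry F : ℤ) = ∑ c, (((F.filter fun x => x c = true).card : ℤ) -
      (F.filter fun x => x c = false).card) := by
    unfold bdry
    push_cast
    refine Finset.sum_congr rfl fun c _ => ?_
    rw [card_filter_true_eq F hF c]
    push_cast
    ring
  have h2 : ∀ c, (((F.filter fun x => x c = true).card : ℤ) - (F.filter fun x => x c = false).card) =
      ∑ x ∈ F, sgn x c := by
    intro c
    rw [Finset.card_filter, Finset.card_filter]
    push_cast
    rw [← Finset.sum_sub_distrib]
    refine Finset.sum_congr rfl fun x _ => ?_
    unfold sgn
    cases x c <;> simp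
  rw [h1]
  simp_rw [h2]
  rw [Finset.sum_comm]
  exact Finset.sum_congr rfl fun x _ => sum_sgn_eq x

/-- Flipping coordinate `c`, an involution of the cube. [folklore] -/
def flipAt (c : ι) (x : ι → Bool) : ι → Bool := update x c (!x c)

omit [Fintype ι] in
/-- `flipAt c` is an involution. [folklore] -/
theorem flipAt_flipAt (c : ι) (x : ι → Bool) : flipAt c (flipAt c x) = x := by
  funext d
  unfold flipAt
  by_cases hd : d = c
  · subst hd; simp
  · simp [update_of_ne hd]

omit [Fintype ι] in
/-- Flipping coordinate `c` negates its sign. [folklore] -/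
theorem sgn_flipAt_self (c : ι) (x : ι → Bool) : sgn (flipAt c x) c = - sgn x c := by
  unfold sgn flipAt
  cases x c <;> simp

omit [Fintype ι] in
/-- Flipping coordinate `c` leaves the other signs unchanged. [folklore] -/
theorem sgn_flipAt_of_ne {c d : ι} (h : d ≠ c) (x : ι → Bool) : sgn (flipAt c x) d = sgn x d := by
  unfold sgn flipAt
  rw [update_of_ne h]

/-- Orthogonality of distinct sign coordinates. [folklore] -/
theorem sum_sgn_mul_sgn_of_ne {c d : ι} (h : c ≠ d) : ∑ x : ι → Bool, sgn x c * sgn x d = 0 := by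
  set φ : (ι → Bool) ≃ (ι → Bool) := Function.Involutive.toPerm (flipAt c) (flipAt_flipAt c)
  have hS : ∑ x : ι → Bool, sgn x c * sgn x d = ∑ x : ι → Bool, sgn (φ x) c * sgn (φ x) d :=
    (Equiv.sum_comp φ (fun x => sgn x c * sgn x d)).symm
  have hneg : ∑ x : ι → Bool, sgn (φ x) c * sgn (φ x) d = - ∑ x : ι → Bool, sgn x c * sgn x d := by
    rw [← Finset.sum_neg_distrib]
    refine Finset.sum_congr rfl fun x _ => ?_
    show sgn (flipAt c x) c * sgn (flipAt c x) d = -(sgn x c * sgn x d)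
    rw [sgn_flipAt_self, sgn_flipAt_of_ne (Ne.symm h)]
    ring
  linarith

omit [Fintype ι] [DecidableEq ι] in
/-- Signs square to `1`. [folklore] -/
theorem sgn_mul_self (x : ι → Bool) (c : ι) : sgn x c * sgn x c = 1 := by
  unfold sgn; split_ifs <;> simp

/-- Second moment of the weight: `∑_x (2|x| - N)² = N · 2^N`. [folklore] -/
theorem sum_sq_weight : ∑ x : ι → Bool, (2 * (wt x : ℤ) - Fintype.card ι) ^ 2 =
    (Fintype.card ι : ℤ) * 2 ^ Fintype.card ι := by
  have h1 : ∀ x : ι → Bool, (2 * (wt x : ℤ) - Fintype.card ι) ^ 2 = ∑ c, ∑ d, sgn x c * sgn x d := by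
    intro x
    rw [← sum_sgn_eq x, sq, Finset.sum_mul_sum]
  simp_rw [h1]
  rw [Finset.sum_comm]
  have h2 : ∀ c : ι, ∑ x : ι → Bool, ∑ d, sgn x c * sgn x d = 2 ^ Fintype.card ι := by
    intro c
    rw [Finset.sum_comm]
    have h3 : ∀ d : ι, ∑ x : ι → Bool, sgn x c * sgn x d =
        if c = d then (2 : ℤ) ^ Fintype.card ι else 0 := by
      intro d
      split_ifs with hcd
      · subst hcd
        simp_rw [sgn_mul_self]
        rw [Finset.sum_const, card_univ, Fintype.card_fun, Fintype.card_bool]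
        simp
      · exact sum_sgn_mul_sgn_of_ne hcd
    simp_rw [h3]
    rw [Finset.sum_ite_eq]
    simp
  simp_rw [h2]
  rw [Finset.sum_const, card_univ, nsmul_eq_mul]

/-- **Total influence of a monotone function is at most `√N`**, integer form: the edge boundary
of an up-set of the `N`-cube satisfies `bdry² ≤ N · 4^N`. [folklore] -/
theorem bdry_sq_le (F : Finset (ι → Bool)) (hF : IsUpperSet (F : Set (ι → Bool))) :
    bdry F ^ 2 ≤ Fintype.card ι * 4 ^ Fintype.card ι := by
  have hZ : (bdry F : ℤ) ≤ ∑ x : ι → Bool, |2 * (wt x : ℤ) - Fintype.card ι| := by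
    rw [bdry_eq_sum F hF]
    calc ∑ x ∈ F, (2 * (wt x : ℤ) - Fintype.card ι) ≤ ∑ x ∈ F, |2 * (wt x : ℤ) - Fintype.card ι| :=
          Finset.sum_le_sum fun x _ => le_abs_self _
      _ ≤ ∑ x : ι → Bool, |2 * (wt x : ℤ) - Fintype.card ι| :=
          Finset.sum_le_sum_of_subset_of_nonneg (subset_univ _) fun x _ _ => abs_nonneg _
  have hCS := sum_mul_sq_le_sq_mul_sq (univ : Finset (ι → Bool))
    (fun x => |2 * (wt x : ℤ) - Fintype.card ι|) (fun _ => (1 : ℤ))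
  simp only [mul_one, one_pow, sum_const, card_univ, nsmul_eq_mul, sq_abs] at hCS
  rw [sum_sq_weight, Fintype.card_fun, Fintype.card_bool] at hCS
  have h0 : (0 : ℤ) ≤ bdry F := by positivity
  have hsq : (bdry F : ℤ) ^ 2 ≤ (∑ x : ι → Bool, |2 * (wt x : ℤ) - Fintype.card ι|) ^ 2 :=
    pow_le_pow_left₀ h0 hZ 2
  have h4 : (4 : ℤ) ^ Fintype.card ι = 2 ^ Fintype.card ι * 2 ^ Fintype.card ι := by
    rw [← mul_pow]; norm_num
  have hfin : (bdry F : ℤ) ^ 2 ≤ (Fintype.card ι : ℤ) * 4 ^ Fintype.card ι := by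
    calc (bdry F : ℤ) ^ 2 ≤ _ := hsq
      _ ≤ _ := hCS
      _ = (Fintype.card ι : ℤ) * 4 ^ Fintype.card ι := by rw [h4]; push_cast; ring
  exact_mod_cast hfin

end Cube

end Summit.PneNP.PneNP.Theorems.MonotoneSuffices.Negative
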